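import Literature.AlgebraicGeometry.Motives.PicardQuarticForm
import Literature.AlgebraicGeometry.Motives.SmoothHypersurfaceExistenceProofs
import Literature.AlgebraicGeometry.Motives.HypersurfaceFieldPoints
import HarnessLib

/-!
# The Picard curve as a smooth plane quartic: the scheme `V₊(y³z - z⁴f(x/z)) ⊂ ℙ²` and its points

For a field `K` with `3 ≠ 0` and a separable quartic `f ∈ K[X]`, the **Picard curve** `y³ = f(x)` has
as smooth projective model the plane quartic `X_F = V₊(F) ⊂ ℙ²_K`, `F = x₁³x₂ - x₂⁴f(x₀/x₂)` the
Picard form of `Motives/PicardQuarticForm`, taken with its reduced induced structure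
(`Motives.SmoothHypersurface.hypersurface F`, Hartshorne II Example 3.2.6). This file proves:

* `isNonsingularForm_picardForm`, `isSmoothHypersurface_hypersurface_picardForm`,
  `isSmoothProjective_hypersurface_picardForm` — **`X_F` is a smooth hypersurface of dimension `1`
  and degree `4`**, in particular a smooth projective geometrically integral curve over `K`
  (`Motives.IsSmoothProjective 1`): the projective Jacobian criterion of the tree
  (`SmoothHypersurface.isSmoothHypersurface_hypersurface`, Hartshorne I Ex. 5.8 with III 10.0.3) fed
  with the algebra of `PicardQuarticForm` (nonsingularity; irreducibility over every overfield).
  Hence, e.g., the tree's `Jacobian`, `CurvePlaces`, `Motives.pointCount`/`ZetaFunction` and Weil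
  cohomology vocabularies apply to the Picard curve.
* `pointsEquiv` — **`X_F(L) = {∞} ⊔ {(a, b) ∈ L² : b³ = f(a)}`** for every field `L ⊇ K`
  (`affinePoint a b = (a : b : 1)`, `inftyPoint = (0 : 1 : 0)`; Hartshorne II Ex. 2.14 via the tree's
  `SmoothHypersurface.pointOfVec`, `exists_eq_pointOfVec`, `pointOfVec_eq_pointOfVec_iff`): a point
  with `z₂ ≠ 0` is `(z₀/z₂ : z₁/z₂ : 1)`, and `z₂ = 0` forces `a₄z₀⁴ = 0`, i.e. the point `∞`.
* `smul_affinePoint`, `smul_inftyPoint`, `pointsEquiv_optionSmul` — the bijection is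
  `Aut(L/K)`-equivariant (`σ` acting coordinatewise, Hartshorne II Ex. 4.7, the tree's
  `SmoothHypersurface.smul_pointOfVec`), and `fixedPointsEquiv` —
  **`{P ∈ X_F(L) : σP = P} ≃ {∞} ⊔ {(a, b) : b³ = f(a), σa = a, σb = b}`**, the scheme-side twin of
  `SuperellipticFunctionField.nonempty_fixedPlaces_equiv_option` (fixed places of the function field
  `L(x)[y]/(y³ - f)`); the comparison of the two counts is `GaloisRepresentations/PicardQuarticPointCount`.

Everything is proved; no named facts (D-0026). Deliberately not here: the identification of the
function field of `X_F` with `K(x)[y]/(y³ - f)` (`SuperellipticFunctionField K K 3 f`) and of its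
places with the closed points (`Motives/CurvePlaces`), and the general superelliptic `y^p = f(x)`
(whose plane model is singular at infinity unless `|p - deg f| ≤ 1`).

## References

* R. Hartshorne, *Algebraic Geometry*, GTM 52 (1977): I Ex. 5.8, II Example 3.2.6, II Ex. 2.14,
  II Ex. 4.7, III Example 10.0.3. [Hartshorne1977]
* J. S. Milne, *Jacobian Varieties*, in Cornell–Silverman, *Arithmetic Geometry* (1986), §1 (the
  smooth projective curve whose Jacobian is taken). [Milne1986JacobianVarieties]
-/

noncomputable section

open MvPolynomial

universe u

namespace Literature.AlgebraicGeometry.Motives.PicardQuartic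

/-! ### The smooth plane quartic `V₊(x₁³ x₂ - F₄) ⊂ ℙ²` -/

section Scheme

open SmoothHypersurface

variable {K : Type u} [Field K]

/-- **The Picard form is a nonsingular form** (`Motives.IsNonsingularForm`) when `3 ≠ 0` in `K` and
`f` is a separable quartic. [cite: Hartshorne1977, I Ex. 5.8] -/
theorem isNonsingularForm_picardForm {f : Polynomial K} (h3 : (3 : K) ≠ 0) (hf : f.natDegree = 4)
    (hsep : f.Separable) : IsNonsingularForm K (picardForm f) := by
  intro 𝔭 hp hF hd i
  have hf4 : f.coeff 4 ≠ 0 := by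
    rw [← hf]
    exact Polynomial.leadingCoeff_ne_zero.mpr (Polynomial.ne_zero_of_natDegree_gt (n := 0) (by omega))
  exact forall_X_mem_of_prime h3 hf.le hf4 hsep 𝔭 hp hF hd i

/-- **The Picard curve `y³ = f(x)` as a smooth plane quartic**: for a separable quartic `f` over a
field `K` with `3 ≠ 0`, the reduced hypersurface `X_F = V₊(x₁³x₂ - x₂⁴ f(x₀/x₂)) ⊂ ℙ²_K`
(`Motives.SmoothHypersurface.hypersurface`, Hartshorne II Example 3.2.6) is a smooth hypersurface of
dimension `1` and degree `4` (`Motives.IsSmoothHypersurface`): smooth of relative dimension `1` over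
`K` by the projective Jacobian criterion (`isNonsingularForm_picardForm`), projective, and
geometrically irreducible (`irreducible_picardForm` over every overfield). This is the smooth
projective model of the Picard curve (genus `3`; the unique point at infinity is `(0 : 1 : 0)`).
[cite: Hartshorne1977, I Ex. 5.8 and II Example 3.2.6] -/
theorem isSmoothHypersurface_hypersurface_picardForm {f : Polynomial K} (h3 : (3 : K) ≠ 0)
    (hf : f.natDegree = 4) (hsep : f.Separable) :
    IsSmoothHypersurface 1 4 (hypersurface (picardForm f)) := by
  have hf4 : f.coeff 4 ≠ 0 := by
    rw [← hf]
    exact Polynomial.leadingCoeff_ne_zero.mpr (Polynomial.ne_zero_of_natDegree_gt (n := 0) (by omega))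
  refine isSmoothHypersurface_hypersurface _ (isHomogeneous_picardForm f) (by norm_num)
    (isNonsingularForm_picardForm h3 hf hsep) fun L _ _ => ?_
  rw [map_picardForm]
  refine irreducible_picardForm _ ?_
  rwa [Polynomial.coeff_map, map_ne_zero_iff _ (algebraMap K L).injective]

/-- The Picard curve is a smooth projective geometrically integral curve over `K`
(`Motives.IsSmoothProjective 1`). [cite: Hartshorne1977, I Ex. 5.8 and II Example 3.2.6] -/
theorem isSmoothProjective_hypersurface_picardForm {f : Polynomial K} (h3 : (3 : K) ≠ 0)
    (hf : f.natDegree = 4) (hsep : f.Separable) :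
    IsSmoothProjective 1 (hypersurface (picardForm f)) :=
  (isSmoothHypersurface_hypersurface_picardForm h3 hf hsep).1

end Scheme


/-! ### Field-valued points: the affine points `(a : b : 1)`, `b³ = f(a)`, and `∞ = (0 : 1 : 0)` -/

section Points

open SmoothHypersurface

variable {K : Type u} [Field K] (f : Polynomial K)

section Ring

variable {L : Type*} [CommRing L] [Algebra K L]

/-- `F₄(a, *, 1) = f(a)`. [folklore] -/
theorem aeval_quarticHom_of_eq_one (hf : f.natDegree ≤ 4) (z : Fin 3 → L) (hz : z 2 = 1) :
    aeval z (quarticHom f) = Polynomial.aeval (z 0) f := by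
  rw [quarticHom, aeval_rename,
    Polynomial.aeval_homogenize_of_eq_one hf _ (by simpa [Function.comp] using hz)]
  rfl

/-- `F₄(a, *, 0) = a₄ a⁴`. [folklore] -/
theorem aeval_quarticHom_of_eq_zero (z : Fin 3 → L) (hz : z 2 = 0) :
    aeval z (quarticHom f) = algebraMap K L (f.coeff 4) * z 0 ^ 4 := by
  rw [quarticHom_eq_sum, map_sum, Finset.sum_eq_single 4]
  · simp
  · intro i hi hi4
    rw [Finset.mem_range] at hi
    simp [hz, zero_pow (show 4 - i ≠ 0 by omega)]
  · simp

/-- `F(z) = z₁³ z₂ - F₄(z)`. [folklore] -/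
theorem aeval_picardForm (z : Fin 3 → L) :
    aeval z (picardForm f) = z 1 ^ 3 * z 2 - aeval z (quarticHom f) := by
  simp [picardForm]

/-- `(a, b, 1)` is a zero of the Picard form iff `b³ = f(a)`. [folklore] -/
theorem aeval_picardForm_vecCons_one (hf : f.natDegree ≤ 4) (a b : L) :
    aeval ![a, b, 1] (picardForm f) = b ^ 3 - Polynomial.aeval a f := by
  rw [aeval_picardForm, aeval_quarticHom_of_eq_one f hf _ (by simp)]
  simp

/-- `(0, 1, 0)` is a zero of the Picard form. [folklore] -/
theorem aeval_picardForm_infty : aeval ![(0 : L), 1, 0] (picardForm f) = 0 := by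
  rw [aeval_picardForm, aeval_quarticHom_of_eq_zero f _ (by simp)]
  simp

end Ring

variable {L : Type u} [Field L] [Algebra K L]

/-- `(a, b, 1) ≠ 0`. [folklore] -/
theorem vecCons_one_ne_zero (a b : L) : (![a, b, 1] : Fin 3 → L) ≠ 0 := fun h => by
  simpa using congr_fun h 2

/-- `(0, 1, 0) ≠ 0`. [folklore] -/
theorem vec_infty_ne_zero : (![(0 : L), 1, 0] : Fin 3 → L) ≠ 0 := fun h => by
  simpa using congr_fun h 1

/-- `pointOfVec` only depends on the coordinate vector. [folklore] -/
theorem pointOfVec_congr {F : MvPolynomial (Fin 3) K} {hF : F.IsHomogeneous 4} {hd hd' : 0 < 4}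
    {z z' : Fin 3 → L} (h : z = z') {hz : z ≠ 0} {hz' : z' ≠ 0} {hFz : aeval z F = 0}
    {hFz' : aeval z' F = 0} :
    pointOfVec F hF hd z hz hFz = pointOfVec F hF hd' z' hz' hFz' := by
  subst h
  rfl

variable {f}

/-- **The affine point `(a : b : 1)`** of the Picard quartic, `b³ = f(a)`. [folklore] -/
def affinePoint (hf : f.natDegree ≤ 4) (a b : L) (h : b ^ 3 = (f.map (algebraMap K L)).eval a) :
    AlgPoints (hypersurface (picardForm f)) L :=
  pointOfVec (picardForm f) (isHomogeneous_picardForm f) four_pos ![a, b, 1] (vecCons_one_ne_zero a b)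
    (by rw [aeval_picardForm_vecCons_one f hf, h, Polynomial.eval_map, ← Polynomial.aeval_def, sub_self])

variable (f L) in
/-- **The point at infinity `∞ = (0 : 1 : 0)`** of the Picard quartic. [folklore] -/
def inftyPoint : AlgPoints (hypersurface (picardForm f)) L :=
  pointOfVec (picardForm f) (isHomogeneous_picardForm f) four_pos ![0, 1, 0] vec_infty_ne_zero
    (aeval_picardForm_infty f)

/-- The map `{∞} ⊔ {(a, b) : b³ = f(a)} → X_F(L)`. [folklore] -/
def optionToPoints (hf : f.natDegree ≤ 4) :
    Option {ab : L × L // ab.2 ^ 3 = (f.map (algebraMap K L)).eval ab.1} →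
      AlgPoints (hypersurface (picardForm f)) L
  | none => inftyPoint f L
  | some ab => affinePoint hf ab.1.1 ab.1.2 ab.2

/-- `optionToPoints none = ∞`. [folklore] -/
@[simp] theorem optionToPoints_none (hf : f.natDegree ≤ 4) :
    optionToPoints (L := L) hf none = inftyPoint f L := rfl

/-- `optionToPoints (a, b) = (a : b : 1)`. [folklore] -/
@[simp] theorem optionToPoints_some (hf : f.natDegree ≤ 4)
    (ab : {ab : L × L // ab.2 ^ 3 = (f.map (algebraMap K L)).eval ab.1}) :
    optionToPoints hf (some ab) = affinePoint hf ab.1.1 ab.1.2 ab.2 := rfl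

/-- An affine point is not the point at infinity. [folklore] -/
theorem affinePoint_ne_inftyPoint (hf : f.natDegree ≤ 4) (a b : L)
    (h : b ^ 3 = (f.map (algebraMap K L)).eval a) : affinePoint hf a b h ≠ inftyPoint f L := by
  intro he
  obtain ⟨c, hc0, hc⟩ := (pointOfVec_eq_pointOfVec_iff _ _ _ _ _ _ _ _ _).mp he
  exact hc0 (by simpa using (congr_fun hc 2).symm)

/-- `F₄(z) = f(z₀/z₂) z₂⁴` when `z₂ ≠ 0`. [folklore] -/
theorem aeval_quarticHom_of_ne_zero (hf : f.natDegree ≤ 4) (z : Fin 3 → L) (hz : z 2 ≠ 0) :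
    aeval z (quarticHom f) = (f.map (algebraMap K L)).eval (z 0 / z 2) * z 2 ^ 4 := by
  rw [quarticHom, aeval_rename, MvPolynomial.aeval_def, ← MvPolynomial.eval_map,
    ← Polynomial.homogenize_map, Polynomial.eval_homogenize (Polynomial.natDegree_map_le.trans hf) _
      (by simpa [Function.comp] using hz)]
  rfl

/-- `(a : b : 1) = (a' : b' : 1)` iff `(a, b) = (a', b')`. [folklore] -/
theorem affinePoint_eq_affinePoint_iff (hf : f.natDegree ≤ 4) {a b a' b' : L}
    (h : b ^ 3 = (f.map (algebraMap K L)).eval a) (h' : b' ^ 3 = (f.map (algebraMap K L)).eval a') :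
    affinePoint hf a b h = affinePoint hf a' b' h' ↔ a = a' ∧ b = b' := by
  constructor
  · intro he
    obtain ⟨c, -, hc⟩ := (pointOfVec_eq_pointOfVec_iff _ _ _ _ _ _ _ _ _).mp he
    have h2 := congr_fun hc 2
    simp only [Matrix.cons_val, Pi.smul_apply, smul_eq_mul, mul_one] at h2
    have h0 := congr_fun hc 0
    have h1 := congr_fun hc 1
    simp [← h2] at h0 h1
    exact ⟨h0.symm, h1.symm⟩
  · rintro ⟨rfl, rfl⟩
    rfl

/-- `{∞} ⊔ {(a, b)} → X_F(L)` is injective. [folklore] -/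
theorem optionToPoints_injective (hf : f.natDegree ≤ 4) :
    Function.Injective (optionToPoints (L := L) hf) := by
  rintro (_ | ab) (_ | ab') h
  · rfl
  · exact absurd h.symm (affinePoint_ne_inftyPoint hf ab'.1.1 ab'.1.2 ab'.2)
  · exact absurd h (affinePoint_ne_inftyPoint hf ab.1.1 ab.1.2 ab.2)
  · simp only [optionToPoints_some] at h
    obtain ⟨h1, h2⟩ := (affinePoint_eq_affinePoint_iff hf _ _).mp h
    rw [Option.some_inj]
    exact Subtype.ext (Prod.ext h1 h2)

/-- **Every `L`-point of the Picard quartic is `∞` or an affine point** (`deg f = 4`): a point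
`(z₀ : z₁ : z₂)` with `z₂ ≠ 0` is `(z₀/z₂ : z₁/z₂ : 1)`; if `z₂ = 0` the equation forces
`a₄ z₀⁴ = 0`, i.e. the point is `(0 : 1 : 0)`. [folklore] -/
theorem optionToPoints_surjective (hf : f.natDegree = 4) :
    Function.Surjective (optionToPoints (L := L) hf.le) := by
  intro Q
  obtain ⟨z, hz, hFz, rfl⟩ := exists_eq_pointOfVec (picardForm f) (isHomogeneous_picardForm f) four_pos Q
  by_cases h2 : z 2 = 0
  · -- the point at infinity
    have hf4 : algebraMap K L (f.coeff 4) ≠ 0 := by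
      rw [map_ne_zero_iff _ (algebraMap K L).injective, ← hf]
      exact Polynomial.leadingCoeff_ne_zero.mpr (Polynomial.ne_zero_of_natDegree_gt (n := 0) (by omega))
    have h0 : z 0 = 0 := by
      rw [aeval_picardForm, aeval_quarticHom_of_eq_zero f z h2, h2, mul_zero, zero_sub, neg_eq_zero,
        mul_eq_zero] at hFz
      exact eq_zero_of_pow_eq_zero (hFz.resolve_left hf4)
    have h1 : z 1 ≠ 0 := by
      intro h1
      apply hz
      funext j
      fin_cases j
      exacts [h0, h1, h2]
    refine ⟨none, ?_⟩
    rw [optionToPoints_none, inftyPoint, pointOfVec_eq_pointOfVec_iff]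
    refine ⟨z 1, h1, funext fun j => ?_⟩
    fin_cases j <;> simp [h0, h2]
  · -- an affine point
    refine ⟨some ⟨(z 0 / z 2, z 1 / z 2), ?_⟩, ?_⟩
    · -- `z₁³ z₂ = f(z₀/z₂) z₂⁴`, divide by `z₂⁴`
      have h := hFz
      rw [aeval_picardForm, sub_eq_zero, aeval_quarticHom_of_ne_zero hf.le z h2, pow_succ _ 3,
        ← mul_assoc] at h
      have h' : z 1 ^ 3 = (f.map (algebraMap K L)).eval (z 0 / z 2) * z 2 ^ 3 := mul_right_cancel₀ h2 h
      change (z 1 / z 2) ^ 3 = (f.map (algebraMap K L)).eval (z 0 / z 2)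
      rw [div_pow, div_eq_iff (pow_ne_zero 3 h2), h']
    · rw [optionToPoints_some, affinePoint, pointOfVec_eq_pointOfVec_iff]
      refine ⟨z 2, h2, funext fun j => ?_⟩
      fin_cases j <;> simp [mul_div_cancel₀ _ h2]


/-- **`X_F(L) = {∞} ⊔ {(a, b) ∈ L² : b³ = f(a)}`** for the Picard quartic (`deg f = 4`), over every
field `L ⊇ K` (Hartshorne II Ex. 2.14: `X_F(L) = {z ≠ 0 : F(z) = 0}/Lˣ`). [folklore] -/
def pointsEquiv (hf : f.natDegree = 4) :
    Option {ab : L × L // ab.2 ^ 3 = (f.map (algebraMap K L)).eval ab.1} ≃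
      AlgPoints (hypersurface (picardForm f)) L :=
  Equiv.ofBijective _ ⟨optionToPoints_injective hf.le, optionToPoints_surjective hf⟩

/-- `pointsEquiv` is `optionToPoints`. [folklore] -/
@[simp] theorem pointsEquiv_apply (hf : f.natDegree = 4)
    (o : Option {ab : L × L // ab.2 ^ 3 = (f.map (algebraMap K L)).eval ab.1}) :
    pointsEquiv hf o = optionToPoints hf.le o := rfl

/-! ### Galois equivariance -/

/-- `σ(b)³ = f(σ(a))` if `b³ = f(a)`, for `σ ∈ Aut(L/K)`. [folklore] -/
theorem eqn_map (σ : L ≃ₐ[K] L) {a b : L} (h : b ^ 3 = (f.map (algebraMap K L)).eval a) :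
    σ b ^ 3 = (f.map (algebraMap K L)).eval (σ a) := by
  rw [Polynomial.eval_map, ← Polynomial.aeval_def] at h ⊢
  rw [← map_pow, h, Polynomial.aeval_algHom_apply]

/-- **`σ • ∞ = ∞`.** [folklore] -/
theorem smul_inftyPoint (σ : L ≃ₐ[K] L) : σ • inftyPoint f L = inftyPoint f L := by
  have h' : aeval (fun j => σ (![(0 : L), 1, 0] j)) (picardForm f) = 0 := by
    have : (fun j => σ (![(0 : L), 1, 0] j)) = ![0, 1, 0] := funext fun j => by fin_cases j <;> simp
    rw [this, aeval_picardForm_infty]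
  rw [inftyPoint, smul_pointOfVec _ σ _ _ _ _ _ h']
  exact pointOfVec_congr (funext fun j => by fin_cases j <;> simp)

/-- **`σ • (a : b : 1) = (σ a : σ b : 1)`.** [folklore] -/
theorem smul_affinePoint (hf : f.natDegree ≤ 4) (σ : L ≃ₐ[K] L) {a b : L}
    (h : b ^ 3 = (f.map (algebraMap K L)).eval a) :
    σ • affinePoint hf a b h = affinePoint hf (σ a) (σ b) (eqn_map σ h) := by
  have h' : aeval (fun j => σ (![a, b, 1] j)) (picardForm f) = 0 := by
    have : (fun j => σ (![a, b, 1] j)) = ![σ a, σ b, 1] := funext fun j => by fin_cases j <;> simp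
    have e := eqn_map σ h
    rw [Polynomial.eval_map, ← Polynomial.aeval_def] at e
    rw [this, aeval_picardForm_vecCons_one f hf, e, sub_self]
  rw [affinePoint, smul_pointOfVec _ σ _ _ _ _ _ h']
  exact pointOfVec_congr (funext fun j => by fin_cases j <;> simp)

/-- The coordinatewise action of `σ` on `{∞} ⊔ {(a, b) : b³ = f(a)}`. [folklore] -/
def optionSmul (σ : L ≃ₐ[K] L) :
    Option {ab : L × L // ab.2 ^ 3 = (f.map (algebraMap K L)).eval ab.1} →
      Option {ab : L × L // ab.2 ^ 3 = (f.map (algebraMap K L)).eval ab.1} :=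
  Option.map fun ab => ⟨(σ ab.1.1, σ ab.1.2), eqn_map σ ab.2⟩

/-- **The bijection `X_F(L) ≃ {∞} ⊔ {affine points}` is `Aut(L/K)`-equivariant.** [folklore] -/
theorem pointsEquiv_optionSmul (hf : f.natDegree = 4) (σ : L ≃ₐ[K] L)
    (o : Option {ab : L × L // ab.2 ^ 3 = (f.map (algebraMap K L)).eval ab.1}) :
    pointsEquiv hf (optionSmul σ o) = σ • pointsEquiv hf o := by
  rcases o with _ | ab
  · exact (smul_inftyPoint σ).symm
  · exact (smul_affinePoint hf.le σ ab.2).symm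

/-- Fixed points of `Option.map g` are `none` and the fixed points of `g`. [folklore] -/
def optionFixedEquiv {T : Type*} (g : T → T) :
    {o : Option T // Option.map g o = o} ≃ Option {t : T // g t = t} where
  toFun o := match o with
    | ⟨none, _⟩ => none
    | ⟨some t, h⟩ => some ⟨t, Option.some_injective _ (by simpa using h)⟩
  invFun o := match o with
    | none => ⟨none, rfl⟩
    | some t => ⟨some t.1, by simp [t.2]⟩
  left_inv := by
    rintro ⟨_ | t, h⟩ <;> rfl
  right_inv := by
    rintro (_ | t) <;> rfl

/-- **The `σ`-fixed `L`-points of the Picard quartic are `∞` and the `σ`-fixed affine points**: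
`{P ∈ X_F(L) : σ P = P} ≃ {∞} ⊔ {(a, b) : b³ = f(a), σ a = a, σ b = b}` — the scheme-side
counterpart of `SuperellipticFunctionField.nonempty_fixedPlaces_equiv_option` (fixed places of the
function field). [folklore] -/
def fixedPointsEquiv (hf : f.natDegree = 4) (σ : L ≃ₐ[K] L) :
    {P : AlgPoints (hypersurface (picardForm f)) L // σ • P = P} ≃
      Option {ab : L × L // ab.2 ^ 3 = (f.map (algebraMap K L)).eval ab.1 ∧ σ ab.1 = ab.1 ∧ σ ab.2 = ab.2} :=
  ((pointsEquiv hf).symm.subtypeEquiv fun P => by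
      conv_lhs => rw [← (pointsEquiv hf).apply_symm_apply P, ← pointsEquiv_optionSmul]
      exact (pointsEquiv hf).injective.eq_iff).trans <|
    (optionFixedEquiv _).trans <| Equiv.optionCongr <|
      (Equiv.subtypeEquivRight fun ab => by
          rw [Subtype.ext_iff, Prod.ext_iff]).trans
        (Equiv.subtypeSubtypeEquivSubtypeInter _ _)

end Points

end Literature.AlgebraicGeometry.Motives.PicardQuartic

end
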